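import Summits.MatrixMultiplication.OmegaCensus.BoxBadDihedralLarge
import Summits.MatrixMultiplication.OmegaCensus.BoxBadSmallGroups
import Summits.MatrixMultiplication.OmegaCensus.BoxUsefulClasses
import Summits.MatrixMultiplication.OmegaCensus.BoxUsefulIndexSix

/-!
# ω-census, family (b3): conjecture C9 on the dihedral family — `D_{2n}` for every `n` with a divisor in `{5,7,8,9,11,12,13,17,19,23,29,31}` is NOT box-useful; `D_2, D_4, D_6, D_8, D_12` ARE

HONEST FRAMING (pub-omega census; verbatim): lottery ticket; floor = certified bounds/negative ranges.
Census BOOKKEEPING (conjecture C9 of the cell; pub-omega stpp-1 gen 18): the dihedral family `DihedralGroup n` (order `2n`) sorted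
by C9, as far as the tree's kernel witnesses reach:
* `dihedralMulHom m k : DihedralGroup m →* DihedralGroup (m * k)` (`r_a ↦ r_{ka}`, `sr_a ↦ sr_{ka}`), injective for `k ≠ 0`
  (the subgroup `⟨r^k, s⟩ ≅ D_{2m}` of `D_{2mk}`), and `not_boxUseful_of_injective'` (a group CONTAINING a box-useless group is
  box-useless — `not_boxUseful_of_injective` fed with the witness that `¬ BoxUseful` unfolds to); hence
  `not_boxUseful_dihedral_of_dvd`: `m ∣ n`, `n ≠ 0`, `D_{2m}` box-useless ⇒ `D_{2n}` box-useless;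
* with the kernel witnesses of `BoxNotUsefulLift` (`D₁₀`), `BoxBadSmallGroups` (`D₁₄, D₁₆, D₁₈`), `BoxBadSmallGroups2`
  (`D₂₂, D₂₄, D₂₆`), `BoxBadDihedralLarge` (`D₃₄, D₃₈, D₄₆, D₅₈, D₆₂`): **`DihedralGroup n` is not box-useful for every `n ≠ 0`
  divisible by one of `5, 7, 8, 9, 11, 12, 13, 17, 19, 23, 29, 31`** (`not_boxUseful_dihedral_of_small_dvd`) — an infinite family;
* the positive side: `DihedralGroup n` IS box-useful for `n = 1, 2` (abelian), `3, 6` (centre of index `6`), `4` (centre of index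
  `4`) — `boxUseful_dihedral_one/two/three/four/six` (C9 (c) classes).
Not covered (yet): `n` odd with all prime factors `≥ 37` (and `2n, 3n, 4n, 6n` for such `n`); the cell's uniform 8-periodic
construction (stpp-1 g18, `BoxBadDihedralLarge` docstring) gives `≥ 4n − 4` independent cells for every odd `n ≥ 9` and would
close the classification '`D_{2n}` box-useful ⟺ n ∈ {1,2,3,4,6}`', but is formalized here only for the listed `n`.
Nothing here is progress on `ω`.
-/

namespace Summit.MatrixMultiplication.OmegaCensus

open Finset ProductBoxBound DihedralGroup

variable {G : Type*} [Group G] [Fintype G] [DecidableEq G]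

/-- A group containing a box-useless group is box-useless (`¬ BoxUseful Q` unfolds to a witness). [folklore] -/
theorem not_boxUseful_of_injective' {Q : Type*} [Group Q] [Fintype Q] [DecidableEq Q] (f : Q →* G)
    (hf : Function.Injective f) (hQ : ¬ BoxUseful Q) : ¬ BoxUseful G := by
  unfold BoxUseful at hQ
  push Not at hQ
  obtain ⟨Y, W, hY, hW, I, hI, hind, hbig⟩ := hQ
  exact not_boxUseful_of_injective f hf hY hW hI hind hbig

/-- A group mapping onto a box-useless group is box-useless. [folklore] -/
theorem not_boxUseful_of_surjective' {Q : Type*} [Group Q] [Fintype Q] [DecidableEq Q] (f : G →* Q)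
    (hf : Function.Surjective f) (hQ : ¬ BoxUseful Q) : ¬ BoxUseful G := by
  unfold BoxUseful at hQ
  push Not at hQ
  obtain ⟨Y, W, hY, hW, I, hI, hind, hbig⟩ := hQ
  exact not_boxUseful_of_surjective f hf hY hW hI hind hbig

/-! ### The embedding `D_{2m} ↪ D_{2mk}` -/

/-- Multiplication by `k`: `ℤ/m → ℤ/(mk)`, `a ↦ k a`. [folklore] -/
def zmodMul (m k : ℕ) : ZMod m →+ ZMod (m * k) :=
  ZMod.lift m ⟨(Int.castAddHom (ZMod (m * k))).comp (AddMonoidHom.mulLeft (k : ℤ)), by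
    simp only [AddMonoidHom.coe_comp, Function.comp_apply, AddMonoidHom.coe_mulLeft, Int.coe_castAddHom,
      Int.cast_mul, Int.cast_natCast]
    have h : ((m * k : ℕ) : ZMod (m * k)) = 0 := ZMod.natCast_self _
    rw [Nat.cast_mul] at h
    exact (mul_comm _ _).trans h⟩

/-- `zmodMul` on integers. [folklore] -/
theorem zmodMul_intCast (m k : ℕ) (a : ℤ) : zmodMul m k (a : ZMod m) = ((k * a : ℤ) : ZMod (m * k)) := by
  rw [zmodMul, ZMod.lift_coe]
  simp only [AddMonoidHom.coe_comp, Function.comp_apply, AddMonoidHom.coe_mulLeft, Int.coe_castAddHom]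

/-- `zmodMul` is injective for `k ≠ 0`. [folklore] -/
theorem zmodMul_injective (m k : ℕ) (hk : k ≠ 0) : Function.Injective (zmodMul m k) := by
  refine (injective_iff_map_eq_zero _).2 fun a ha ↦ ?_
  obtain ⟨z, rfl⟩ := ZMod.intCast_surjective a
  rw [zmodMul_intCast, ZMod.intCast_zmod_eq_zero_iff_dvd] at ha
  rw [ZMod.intCast_zmod_eq_zero_iff_dvd]
  push_cast at ha
  rw [mul_comm (k : ℤ) z] at ha
  have hk' : (k : ℤ) ≠ 0 := by exact_mod_cast hk
  exact (mul_dvd_mul_iff_right hk').1 ha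

/-- **The embedding `D_{2m} ↪ D_{2mk}`**: `r_a ↦ r_{ka}`, `sr_a ↦ sr_{ka}` (image `⟨r^k, s⟩`). [folklore] -/
def dihedralMulHom (m k : ℕ) : DihedralGroup m →* DihedralGroup (m * k) where
  toFun g := match g with
    | r a => r (zmodMul m k a)
    | sr a => sr (zmodMul m k a)
  map_one' := by
    show r (zmodMul m k 0) = r 0
    rw [map_zero]
  map_mul' a b := by
    rcases a with a | a <;> rcases b with b | b
    · show r (zmodMul m k (a + b)) = r (zmodMul m k a) * r (zmodMul m k b)
      rw [r_mul_r, map_add]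
    · show sr (zmodMul m k (b - a)) = r (zmodMul m k a) * sr (zmodMul m k b)
      rw [r_mul_sr, map_sub]
    · show sr (zmodMul m k (a + b)) = sr (zmodMul m k a) * r (zmodMul m k b)
      rw [sr_mul_r, map_add]
    · show r (zmodMul m k (b - a)) = sr (zmodMul m k a) * sr (zmodMul m k b)
      rw [sr_mul_sr, map_sub]

/-- The embedding is injective for `k ≠ 0`. [folklore] -/
theorem dihedralMulHom_injective (m k : ℕ) (hk : k ≠ 0) : Function.Injective (dihedralMulHom m k) := by
  intro a b h
  rcases a with a | a <;> rcases b with b | b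
  · have : zmodMul m k a = zmodMul m k b := by simpa [dihedralMulHom] using h
    rw [zmodMul_injective m k hk this]
  · simp [dihedralMulHom] at h
  · simp [dihedralMulHom] at h
  · have : zmodMul m k a = zmodMul m k b := by simpa [dihedralMulHom] using h
    rw [zmodMul_injective m k hk this]

/-- **`m ∣ n`, `n ≠ 0`, `D_{2m}` box-useless ⇒ `D_{2n}` box-useless.** [folklore] -/
theorem not_boxUseful_dihedral_of_dvd {m n : ℕ} [NeZero m] [NeZero n] (hmn : m ∣ n)
    (hm : ¬ BoxUseful (DihedralGroup m)) : ¬ BoxUseful (DihedralGroup n) := by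
  have hn : n ≠ 0 := NeZero.ne n
  obtain ⟨k, rfl⟩ := hmn
  have hk : k ≠ 0 := fun h => hn (by rw [h, mul_zero])
  exact not_boxUseful_of_injective' (dihedralMulHom m k) (dihedralMulHom_injective m k hk) hm

/-- **`DihedralGroup n` is not box-useful whenever `n ≠ 0` has a divisor among `5, 7, 8, 9, 11, 12, 13, 17, 19, 23, 29, 31`**
(the kernel witnesses of `D₁₀, D₁₄, D₁₆, D₁₈, D₂₂, D₂₄, D₂₆, D₃₄, D₃₈, D₄₆, D₅₈, D₆₂` lifted along `⟨r^k, s⟩ ≅ D_{2m}`). [folklore] -/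
theorem not_boxUseful_dihedral_of_small_dvd {n : ℕ} [NeZero n] {m : ℕ}
    (hm : m = 5 ∨ m = 7 ∨ m = 8 ∨ m = 9 ∨ m = 11 ∨ m = 12 ∨ m = 13 ∨ m = 17 ∨ m = 19 ∨ m = 23 ∨ m = 29 ∨ m = 31)
    (hmn : m ∣ n) : ¬ BoxUseful (DihedralGroup n) := by
  rcases hm with rfl | rfl | rfl | rfl | rfl | rfl | rfl | rfl | rfl | rfl | rfl | rfl
  · exact not_boxUseful_dihedral_of_dvd hmn not_boxUseful_dihedral5
  · exact not_boxUseful_dihedral_of_dvd hmn not_boxUseful_dihedral7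
  · exact not_boxUseful_dihedral_of_dvd hmn not_boxUseful_dihedral8
  · exact not_boxUseful_dihedral_of_dvd hmn not_boxUseful_dihedral9
  · exact not_boxUseful_dihedral_of_dvd hmn not_boxUseful_dihedral11
  · exact not_boxUseful_dihedral_of_dvd hmn not_boxUseful_dihedral12
  · exact not_boxUseful_dihedral_of_dvd hmn not_boxUseful_dihedral13
  · exact not_boxUseful_dihedral_of_dvd hmn not_boxUseful_dihedral17
  · exact not_boxUseful_dihedral_of_dvd hmn not_boxUseful_dihedral19
  · exact not_boxUseful_dihedral_of_dvd hmn not_boxUseful_dihedral23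
  · exact not_boxUseful_dihedral_of_dvd hmn not_boxUseful_dihedral29
  · exact not_boxUseful_dihedral_of_dvd hmn not_boxUseful_dihedral31

/-! ### The five box-useful dihedral groups -/

omit [Fintype G] [DecidableEq G] in
/-- The centre of a commutative-by-`decide` group is everything. [folklore] -/
theorem center_index_one_of_comm (h : ∀ a b : G, a * b = b * a) : (Subgroup.center G).index = 1 := by
  rw [Subgroup.index_eq_one, Subgroup.eq_top_iff']
  intro x; rw [Subgroup.mem_center_iff]; intro g; exact h g x

/-- `D_2` (`n = 1`, `≅ C₂`) is box-useful. [folklore] -/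
theorem boxUseful_dihedral_one : BoxUseful (DihedralGroup 1) :=
  BoxUseful.of_index_center_one (center_index_one_of_comm (by decide))

/-- `D_4` (`n = 2`, Klein four-group) is box-useful. [folklore] -/
theorem boxUseful_dihedral_two : BoxUseful (DihedralGroup 2) :=
  BoxUseful.of_index_center_one (center_index_one_of_comm (by decide))

/-- `D_6 ≅ S₃` (`n = 3`): centre of index `6`, box-useful. [folklore] -/
theorem boxUseful_dihedral_three : BoxUseful (DihedralGroup 3) := by
  apply BoxUseful.of_index_center_six
  rw [center_eq_bot_of_odd_ne_one (by decide) (by decide), Subgroup.index_bot, nat_card]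

omit [Fintype G] [DecidableEq G] in
/-- The index of the centre from an element count of the centre. [folklore] -/
theorem center_index_of_card {c i : ℕ} (hc : Nat.card (Subgroup.center G) = c) (hG : Nat.card G = c * i) (hc0 : c ≠ 0) :
    (Subgroup.center G).index = i := by
  have := (Subgroup.center G).card_mul_index
  rw [hc, hG] at this
  exact Nat.eq_of_mul_eq_mul_left (Nat.pos_of_ne_zero hc0) this

/-- `D_8` (`n = 4`): centre `{1, r²}` of index `4`, box-useful. [folklore] -/
theorem boxUseful_dihedral_four : BoxUseful (DihedralGroup 4) := by
  apply BoxUseful.of_index_center_four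
  apply center_index_of_card (c := 2) _ (by rw [nat_card]) (by norm_num)
  rw [Nat.card_eq_fintype_card]; decide

/-- `D_12` (`n = 6`): centre `{1, r³}` of index `6`, box-useful. [folklore] -/
theorem boxUseful_dihedral_six : BoxUseful (DihedralGroup 6) := by
  apply BoxUseful.of_index_center_six
  apply center_index_of_card (c := 2) _ (by rw [nat_card]) (by norm_num)
  rw [Nat.card_eq_fintype_card]; decide

end Summit.MatrixMultiplication.OmegaCensus
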